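/-
Copyright (c) 2026 the pub-hodgecm-mathlib formalisation cell (harness21).  Prover seat hodgecm-mathlib-F0P3a-p07 (g11): road «S3-tree» (LEAD F0P3a-plan (g11), architect
A-p16 (g29) ruling A-81 (1) «SPAN-0-ram»: (a) «htr₂-ram»), brick htr₂-ram, FILE 2 of 2 «TYPE-TWO TRANSITIVITY AT A TAMELY RAMIFIED PLACE»; 2026-09-01.
§5's transitivity proof is ADAPTED from ★ B-p14 (g35) `UnitaryLatticeTreeTypeTwoTransitive` §38 (signs `σϖ = −ϖ`); §3 from ★ `UnitaryLatticeTreeTypeTwoHyperbolic` §35.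
-/
import Literature.NumberTheory.Automorphic.UnitaryLatticeTreeTypeTwoGramOfTrace    -- htr₂-ram FILE 1 (this seat): `exists_orthogonal_basis_of_trace`, `typeTwo_block_of_involution` (datum-free ★ B-p14 §30–§32)
import Literature.NumberTheory.Automorphic.UnitaryLatticeTreeTypeTwoTransitive    -- ★ T1d′ FILE 3 (B-p14 (g35)): `B₀_mulVec_single_eq_gram`, `transpose_of_mulVec_single`, `det_gram_three`, `det_antidiagonal_three`; brings ★ FILE 2 `eq_one_of_mul_self_eq_one`
import HarnessLib

/-!
# The lattice graph of a hermitian space — htr₂-ram FILE 2: `U(σ, J₀)` IS TRANSITIVE ON THE TYPE-TWO VERTICES AT A TAMELY RAMIFIED PLACE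
# (Jacobowitz 1962 §4, §8; O'Meara §82F; Bruhat–Tits 1972 §10)

Topic `NumberTheory/Automorphic`; namespace `Literature.NumberTheory.Automorphic.UnitaryLatticeTree`.  THEOREMS ONLY (no definition, no instance, no notation, no named fact,
no `sorry`); kernel lane.  Cell `pub/hodgecm-mathlib` (D-0151), crux H413 = `stmt-HodgeConjecture-24833`; road «S3-tree», brick **htr₂-ram** (architect A-81 (1)(a)): the
discharge of the binder `htr₂` of ★ S-a3-ram `exists_isSelfDualLattice_gt_mapGL_eq_of_charpoly_of_neg` at a TAMELY RAMIFIED place — the twin of ★ B-p14 T1d′.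
THE RAMIFIED BLOCK (hypotheses, as in ★ S-a3-ram): `σ` an involution preserving `v`; `ϖ` a uniformiser with `σϖ = −ϖ`; `σ` trivial on the residue field (`|σx − x| < 1` on `𝒪`);
`|2| = 1` (tame); and the (norm) property «a `σ`-fixed `1`-unit `u` is a norm `z·σz` with `|z − 1| ≤ |u − 1|» — VERBATIM the (norm) field of `UnramifiedLocalConjDatum`, true at a
tamely ramified place by Hensel square roots in the fixed field (odd residue characteristic).
THE MATHEMATICS.  `M = latt g` a type-two vertex (`G = ᵗσ(g)J₀g` integral, `ϖG⁻¹` integral, `|det G| = |ϖ|²`).  FILE 1 (datum-free ★ B-p14 §30–§32, trace element `t = 1∕2`)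
gives a basis `x ⊥ c₁, c₂` with `|h(x,x)| = 1`, `h(cₐ,c_b) ∈ ϖ𝒪`, `|det G₁| = |ϖ|²`.  (§1) `σr = −r ∈ 𝒪 ⇒ r ∈ 𝔪`; the RAMIFIED isotropy equation `c + α − σα + qασα = 0`
(`σc = −c ∈ 𝔪`, `σq = −q`) is solvable with `|α| ≤ |c|` — `q = 0`: `α = −c∕2`; `q ≠ 0`: it is the NORM equation `N(1 − qα) = 1 + qc`.  (§2) THE NEAR-HYPERBOLIC PAIR IS FREE: `h(c₁,c₁) = ϖr`
is `σ`-fixed, so `σr = −r`, so `r ∈ 𝔪` — the residual form `ϖ⁻¹h` on the `ϖ`-modular plane is ALTERNATING (no isotropic vector of the ambient form is needed, contrast ★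
`exists_near_hyperbolic_pair`) — and the unit determinant of `ϖ⁻¹G₁` then makes `u = h(c₁,c₂)∕ϖ` a unit: `n₀ = c₁`, `n₁ = u⁻¹c₂`.  (§3) EXACT ISOTROPY: `f₀ = n₀ + αn₁`,
`f₂ = w⁻¹n₁ + ½(h(w⁻¹n₁,w⁻¹n₁)∕ϖ)·f₀`.  (§4) the adapted vectors `x, f₀, f₂ ∈ M`.  (§5) `N₁` is type two at a ramified place (Gram `[[0,0,ϖ],[0,1,0],[−ϖ,0,0]]`), and ★ B-p14's
determinant-class argument with `h(f₂,f₀) = σϖ = −ϖ`: `det Gram(f₀|x|f₂) = εϖ² = −N(det C)`, so `ε = N(det C∕ϖ)` (`ϖσϖ = −ϖ²`), `u = (f₀ | z⁻¹x | ϖ⁻¹f₂) ∈ U(σ,J₀)`, `u·N₁ ≤ M` both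
type two ⇒ `M = u·N₁` (★ `eq_of_le_of_isVertexLattice`).
HONEST LABEL: HC_CM is proved only modulo the 2 remaining named inputs (hLiu418 24832, h413 24833) until rung 0 closes; nothing printed is asserted here (elementary lattice
algebra over a valuation ring with involution); S3 (`stub_N6nsS3id`) stays a print row until the road's END lands.

* §1 `v_lt_one_of_map_eq_neg`, **`exists_isotropic_coeff_of_neg`**.  §2 **`exists_near_hyperbolic_pair_of_neg`**.  §3 **`exists_hyperbolic_pair_of_near_pair_of_neg`**.
* §4 **`exists_adapted_vectors_of_isVertexLattice_two_of_neg`**.  §5 `isVertexLattice_two_N₁_of_neg`, **`exists_mapGL_N₁_eq_of_isVertexLattice_two_of_neg`**,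
  `forall_isVertexLattice_two_exists_mapGL_N₁_eq_of_neg` (= «htr₂-ram»).

## References
* [Jacobowitz1962] R. Jacobowitz, *Hermitian forms over local fields*, Amer. J. Math. 84 (1962), §4 (Jordan splittings), §8 (ramified non-dyadic: `ϖ`-modular planes are hyperbolic).
* [Omeara1963] O. T. O'Meara, *Introduction to Quadratic Forms* (1963), §82F, §63A (Hensel square roots).
* [Serre1979] J.-P. Serre, *Local Fields*, GTM 67 (1979), Ch. V §2–§3 (norms of units).
* [BruhatTits1972] F. Bruhat, J. Tits, *Groupes réductifs sur un corps local I*, Publ. Math. IHÉS 41 (1972), §10.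
-/

set_option autoImplicit false

noncomputable section

open scoped Valued WithZero Matrix MatrixGroups

namespace Literature.NumberTheory.Automorphic.UnitaryLatticeTree

open Literature.NumberTheory.Automorphic Literature.NumberTheory.Automorphic.HermitianLattice
open Literature.NumberTheory.Automorphic.CartanUnique

variable {K : Type*} [Field K] [Valued K ℤᵐ⁰] {σ : K →+* K} {ϖ : K}

section Ramified

variable {N : ℕ}

/-! ## §1 Two valuation facts at a tamely ramified place -/

/-- At a tamely ramified place (`σ` trivial on the residue field, `|2| = 1`) an integral `r` with `σr = −r` lies in `𝔪`: `|σr − r| = |2r| < 1`. [cite: Jacobowitz1962, §8] -/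
theorem v_lt_one_of_map_eq_neg (hres : ∀ x : K, Valued.v x ≤ 1 → Valued.v (σ x - x) < 1) (h2 : Valued.v (2 : K) = 1)
    {r : K} (hr : Valued.v r ≤ 1) (hσr : σ r = -r) : Valued.v r < 1 := by
  have h := hres r hr
  rw [hσr, show -r - r = -(2 * r) by ring, Valuation.map_neg, map_mul, h2, one_mul] at h
  exact h

/-- **The RAMIFIED isotropy equation** (replaces ★ `UnramifiedLocalConjDatum.exists_isotropic_coeff`): for `σc = −c ∈ 𝔪`, `σq = −q ∈ 𝒪` there is `α` with `|α| ≤ |c|` and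
`c + α − σα + q·α·σα = 0`.  `q = 0`: `α = −c∕2` (`|2| = 1`); `q ≠ 0`: with `β = qα` the equation reads `N(1 − β) = 1 + qc`, and `1 + qc` is a `σ`-FIXED `1`-unit, hence a norm
`z·σz` with `|z − 1| ≤ |qc|` by the (norm) property — the same axiom as in the unramified datum; `α = (1 − z)∕q`. [cite: Jacobowitz1962, §8] [cite: Serre1979, Ch. V §2–§3] -/
theorem exists_isotropic_coeff_of_neg (h2 : Valued.v (2 : K) = 1)
    (hnorm : ∀ u : K, σ u = u → Valued.v (u - 1) < 1 → ∃ z : K, z * σ z = u ∧ Valued.v (z - 1) ≤ Valued.v (u - 1))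
    {c q : K} (hσc : σ c = -c) (hσq : σ q = -q) (hvq : Valued.v q ≤ 1) (hvc : Valued.v c < 1) :
    ∃ α : K, Valued.v α ≤ Valued.v c ∧ c + α - σ α + q * (α * σ α) = 0 := by
  have h20 : (2 : K) ≠ 0 := fun h => by rw [h, map_zero] at h2; exact zero_ne_one h2
  by_cases hq : q = 0
  · refine ⟨-(c / 2), ?_, ?_⟩
    · rw [Valuation.map_neg, map_div₀, h2, div_one]
    · rw [hq, zero_mul, add_zero, map_neg, map_div₀, hσc, map_ofNat]
      field_simp
      ring
  · have hσu : σ (1 + q * c) = 1 + q * c := by rw [map_add, map_one, map_mul, hσq, hσc]; ring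
    have hvqc : Valued.v (q * c) < 1 := by
      rw [map_mul]
      calc Valued.v q * Valued.v c ≤ 1 * Valued.v c := mul_le_mul' hvq le_rfl
        _ < 1 := by rw [one_mul]; exact hvc
    have hu1 : Valued.v ((1 + q * c) - 1) < 1 := by rw [show (1 + q * c) - 1 = q * c by ring]; exact hvqc
    obtain ⟨z, hz, hz1⟩ := hnorm _ hσu hu1
    rw [show (1 + q * c) - 1 = q * c by ring, map_mul] at hz1
    have hvq0 : Valued.v q ≠ 0 := (Valuation.ne_zero_iff _).2 hq
    refine ⟨(1 - z) / q, ?_, ?_⟩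
    · rw [map_div₀, div_le_iff₀ (zero_lt_iff.2 hvq0), mul_comm, show (1 - z) = -(z - 1) by ring, Valuation.map_neg]
      exact hz1
    · have hσα : σ ((1 - z) / q) = (σ z - 1) / q := by rw [map_div₀, map_sub, map_one, hσq, div_neg, neg_div', neg_sub]
      rw [hσα]
      field_simp
      linear_combination (-1 : K) * hz

/-! ## §2 A near-hyperbolic pair in the `ϖ`-modular plane: free at a ramified place -/

/-- **A NEAR-HYPERBOLIC PAIR IN THE `ϖ`-MODULAR PLANE AT A RAMIFIED PLACE** (vector form, any rank; compare ★ `exists_near_hyperbolic_pair`, which needs an isotropic vector of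
the ambient form).  `M` an `𝒪`-module of vectors, `c₁, c₂ ∈ M` orthogonal to `x`, `h(cₐ,c_b) ∈ ϖ𝒪`, `|h(c₁,c₁)h(c₂,c₂) − h(c₁,c₂)h(c₂,c₁)| = |ϖ|²`.  Then `n₀ = c₁` and `n₁ = u⁻¹c₂`
(`u = h(c₁,c₂)∕ϖ`) satisfy `|h(n₀,n₀)| ≤ |ϖ|²`, `h(n₀,n₁) = ϖ`, `|h(n₁,n₁)| ≤ |ϖ|`: indeed `h(c₁,c₁) = ϖr` is `σ`-fixed, so `σr = −r`, so `r ∈ 𝔪` (`v_lt_one_of_map_eq_neg`) — the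
residual form `ϖ⁻¹h` on the plane is ALTERNATING — and then the unit determinant of `ϖ⁻¹G₁` forces `|u| = 1`. [cite: Jacobowitz1962, §8] [cite: Omeara1963, §82F] -/
theorem exists_near_hyperbolic_pair_of_neg (hσ : ∀ x, σ (σ x) = x) (hvσ : ∀ a, Valued.v (σ a) = Valued.v a)
    (hϖ : Valued.v ϖ = WithZero.exp (-1 : ℤ)) (hσϖ : σ ϖ = -ϖ) (hres : ∀ x : K, Valued.v x ≤ 1 → Valued.v (σ x - x) < 1) (h2 : Valued.v (2 : K) = 1)
    (M : Submodule 𝒪[K] (Fin N → K)) {x c₁ c₂ : Fin N → K}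
    (hc₁ : c₁ ∈ M) (hc₂ : c₂ ∈ M) (h01 : B₀ σ N x c₁ = 0) (h02 : B₀ σ N x c₂ = 0)
    (hG11 : Valued.v (B₀ σ N c₁ c₁) ≤ Valued.v ϖ) (hG12 : Valued.v (B₀ σ N c₁ c₂) ≤ Valued.v ϖ) (hG21 : Valued.v (B₀ σ N c₂ c₁) ≤ Valued.v ϖ)
    (hG22 : Valued.v (B₀ σ N c₂ c₂) ≤ Valued.v ϖ) (hdet : Valued.v (B₀ σ N c₁ c₁ * B₀ σ N c₂ c₂ - B₀ σ N c₁ c₂ * B₀ σ N c₂ c₁) = Valued.v ϖ ^ 2) :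
    ∃ n₀ n₁ : Fin N → K, n₀ ∈ M ∧ n₁ ∈ M ∧ B₀ σ N x n₀ = 0 ∧ B₀ σ N x n₁ = 0 ∧
      Valued.v (B₀ σ N n₀ n₀) ≤ Valued.v ϖ ^ 2 ∧ B₀ σ N n₀ n₁ = ϖ ∧ Valued.v (B₀ σ N n₁ n₁) ≤ Valued.v ϖ := by
  have hϖ0 : ϖ ≠ 0 := uniformizer_ne_zero hϖ
  have hvϖ0 : Valued.v ϖ ≠ 0 := (Valuation.ne_zero_iff Valued.v).2 hϖ0
  have hlt : ∀ z : K, Valued.v z < 1 ↔ Valued.v z ≤ Valued.v ϖ := fun z => by rw [hϖ]; exact v_lt_one_iff z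
  have hu : ∀ {a : K}, Valued.v a ≤ Valued.v ϖ → Valued.v (a / ϖ) ≤ 1 := fun ha => by rw [map_div₀]; exact div_le_one_of_le₀ ha zero_le
  -- the four entries of `ϖ⁻¹G₁`
  set u₁₁ : K := B₀ σ N c₁ c₁ / ϖ with hu₁₁
  set u₁₂ : K := B₀ σ N c₁ c₂ / ϖ with hu₁₂
  set u₂₁ : K := B₀ σ N c₂ c₁ / ϖ with hu₂₁
  set u₂₂ : K := B₀ σ N c₂ c₂ / ϖ with hu₂₂
  have hδ : Valued.v (u₁₁ * u₂₂ - u₁₂ * u₂₁) = 1 := by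
    have h : u₁₁ * u₂₂ - u₁₂ * u₂₁ = (B₀ σ N c₁ c₁ * B₀ σ N c₂ c₂ - B₀ σ N c₁ c₂ * B₀ σ N c₂ c₁) / ϖ ^ 2 := by
      rw [hu₁₁, hu₁₂, hu₂₁, hu₂₂]; field_simp
    rw [h, map_div₀, map_pow, hdet, div_self (pow_ne_zero 2 hvϖ0)]
  -- `u₁₁ ∈ 𝔪`: the residual form is alternating
  have hσu₁₁ : σ u₁₁ = -u₁₁ := by
    rw [hu₁₁, map_div₀, hσϖ, (isHermitianForm_B₀ hσ).apply_self c₁, div_neg]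
  have hu₁₁lt : Valued.v u₁₁ < 1 := v_lt_one_of_map_eq_neg hres h2 (hu hG11) hσu₁₁
  -- hence `|u₁₂| = 1`
  have hu₁₂v : Valued.v u₁₂ = 1 := by
    have h22 : Valued.v u₂₂ ≤ 1 := hu hG22
    have h21 : Valued.v u₂₁ ≤ 1 := hu hG21
    have h12 : Valued.v u₁₂ ≤ 1 := hu hG12
    by_contra hne
    have h12lt : Valued.v u₁₂ < 1 := lt_of_le_of_ne h12 hne
    have hlt1 : Valued.v (u₁₁ * u₂₂ - u₁₂ * u₂₁) < 1 := by
      refine Valuation.map_sub_lt _ ?_ ?_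
      · rw [map_mul]; exact lt_of_le_of_lt (mul_le_of_le_one_right' h22) hu₁₁lt
      · rw [map_mul]; exact lt_of_le_of_lt (mul_le_of_le_one_right' h21) h12lt
    rw [hδ] at hlt1; exact lt_irrefl _ hlt1
  have hu₁₂0 : u₁₂ ≠ 0 := fun h => by rw [h, map_zero] at hu₁₂v; exact zero_ne_one hu₁₂v
  -- the pair `n₀ = c₁`, `n₁ = u₁₂⁻¹ c₂`
  refine ⟨c₁, u₁₂⁻¹ • c₂, hc₁, smul_mem_of_v_le _ (by rw [map_inv₀, hu₁₂v, inv_one]) hc₂, h01, by rw [form_smul_right, h02, mul_zero], ?_, ?_, ?_⟩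
  · have h : B₀ σ N c₁ c₁ = ϖ * u₁₁ := by rw [hu₁₁]; field_simp
    rw [h, map_mul, pow_two]
    exact mul_le_mul' le_rfl ((hlt _).1 hu₁₁lt)
  · have h : B₀ σ N c₁ c₂ = ϖ * u₁₂ := by rw [hu₁₂]; field_simp
    rw [form_smul_right, h, ← mul_assoc, mul_comm u₁₂⁻¹, mul_assoc, inv_mul_cancel₀ hu₁₂0, mul_one]
  · rw [form_smul_left, form_smul_right, map_mul, map_mul, hvσ, map_inv₀, hu₁₂v, inv_one, one_mul, one_mul]; exact hG22

/-! ## §3 Exact isotropy: a hyperbolic pair from a near-hyperbolic pair at a ramified place (any rank) -/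

/-- **A HYPERBOLIC PAIR FROM A NEAR-HYPERBOLIC PAIR AT A RAMIFIED PLACE** (any rank `N`; twin of ★ `exists_hyperbolic_pair_of_near_pair`).  If `n₀, n₁ ∈ M` are orthogonal to `x`
with `|h(n₀,n₀)| ≤ |ϖ|²`, `h(n₀,n₁) = ϖ`, `|h(n₁,n₁)| ≤ |ϖ|`, then there are `f₀, f₂ ∈ M`, orthogonal to `x`, with `h(f₀,f₀) = h(f₂,f₂) = 0` and `h(f₀,f₂) = ϖ`:
`f₀ = n₀ + αn₁` with `c + α − σα + qασα = 0` (`c = h(n₀,n₀)∕ϖ`, `q = h(n₁,n₁)∕ϖ`, both ANTI-fixed since `σϖ = −ϖ`; `exists_isotropic_coeff_of_neg`), and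
`f₂ = g₂ + ½(h(g₂,g₂)∕ϖ)·f₀` with `g₂ = w⁻¹n₁`, `h(f₀,n₁) = ϖw` (`h(g₂,f₀) = σϖ = −ϖ`). [cite: Jacobowitz1962, §8] [cite: Omeara1963, §82F] -/
theorem exists_hyperbolic_pair_of_near_pair_of_neg (hσ : ∀ x, σ (σ x) = x) (hvσ : ∀ a, Valued.v (σ a) = Valued.v a)
    (hϖ : Valued.v ϖ = WithZero.exp (-1 : ℤ)) (hσϖ : σ ϖ = -ϖ) (h2 : Valued.v (2 : K) = 1)
    (hnorm : ∀ u : K, σ u = u → Valued.v (u - 1) < 1 → ∃ z : K, z * σ z = u ∧ Valued.v (z - 1) ≤ Valued.v (u - 1))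
    (M : Submodule 𝒪[K] (Fin N → K)) {x n₀ n₁ : Fin N → K}
    (hn₀ : n₀ ∈ M) (hn₁ : n₁ ∈ M) (hx₀ : B₀ σ N x n₀ = 0) (hx₁ : B₀ σ N x n₁ = 0)
    (h₀₀ : Valued.v (B₀ σ N n₀ n₀) ≤ Valued.v ϖ ^ 2) (h₀₁ : B₀ σ N n₀ n₁ = ϖ) (h₁₁ : Valued.v (B₀ σ N n₁ n₁) ≤ Valued.v ϖ) :
    ∃ f₀ f₂ : Fin N → K, f₀ ∈ M ∧ f₂ ∈ M ∧ B₀ σ N f₀ f₀ = 0 ∧ B₀ σ N f₂ f₂ = 0 ∧ B₀ σ N f₀ f₂ = ϖ ∧ B₀ σ N x f₀ = 0 ∧ B₀ σ N x f₂ = 0 := by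
  have hϖ0 : ϖ ≠ 0 := uniformizer_ne_zero hϖ
  have hvϖ0 : Valued.v ϖ ≠ 0 := (Valuation.ne_zero_iff Valued.v).2 hϖ0
  have hϖ1 : Valued.v ϖ < 1 := by rw [hϖ, ← WithZero.exp_zero, WithZero.exp_lt_exp]; omega
  have h20 : (2 : K) ≠ 0 := fun h => by rw [h, map_zero] at h2; exact zero_ne_one h2
  have herm : ∀ y z : Fin N → K, B₀ σ N z y = σ (B₀ σ N y z) := fun y z => (isHermitianForm_B₀ hσ y z).symm
  -- `c = h(n₀,n₀)/ϖ ∈ 𝔪` and `q = h(n₁,n₁)/ϖ ∈ 𝒪`, both ANTI-fixed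
  obtain ⟨c, hB₀₀, hσc, hvc⟩ : ∃ c : K, B₀ σ N n₀ n₀ = ϖ * c ∧ σ c = -c ∧ Valued.v c < 1 := by
    refine ⟨B₀ σ N n₀ n₀ / ϖ, by field_simp, by rw [map_div₀, hσϖ, (isHermitianForm_B₀ hσ).apply_self n₀, div_neg], ?_⟩
    rw [map_div₀, div_lt_iff₀ (zero_lt_iff.2 hvϖ0), one_mul]
    calc Valued.v (B₀ σ N n₀ n₀) ≤ Valued.v ϖ ^ 2 := h₀₀
      _ < Valued.v ϖ := by rw [pow_two]; exact mul_lt_of_lt_one_left (zero_lt_iff.2 hvϖ0) hϖ1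
  obtain ⟨q, hB₁₁, hσq, hvq⟩ : ∃ q : K, B₀ σ N n₁ n₁ = ϖ * q ∧ σ q = -q ∧ Valued.v q ≤ 1 := by
    refine ⟨B₀ σ N n₁ n₁ / ϖ, by field_simp, by rw [map_div₀, hσϖ, (isHermitianForm_B₀ hσ).apply_self n₁, div_neg], ?_⟩
    rw [map_div₀]; exact div_le_one_of_le₀ h₁₁ zero_le
  obtain ⟨α, hαv, hαeq⟩ := exists_isotropic_coeff_of_neg h2 hnorm hσc hσq hvq hvc
  have hα1 : Valued.v α ≤ 1 := hαv.trans hvc.le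
  have h₁₀ : B₀ σ N n₁ n₀ = -ϖ := by rw [herm, h₀₁, hσϖ]
  -- the exactly isotropic `f₀ = n₀ + α n₁`
  set f₀ : Fin N → K := n₀ + α • n₁ with hf₀
  have hf₀M : f₀ ∈ M := M.add_mem hn₀ (smul_mem_of_v_le _ hα1 hn₁)
  have hxf₀ : B₀ σ N x f₀ = 0 := by rw [hf₀, map_add, form_smul_right, hx₀, hx₁, mul_zero, add_zero]
  have hf₀f₀ : B₀ σ N f₀ f₀ = 0 := by
    have h : B₀ σ N f₀ f₀ = ϖ * (c + α - σ α + q * (α * σ α)) := by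
      simp only [hf₀, map_add, LinearMap.add_apply, form_smul_left, form_smul_right, h₀₁, h₁₀, hB₀₀, hB₁₁]; ring
    rw [h, hαeq, mul_zero]
  -- the partner `g₂ = w⁻¹ n₁`, `h(f₀, g₂) = ϖ`
  have hf₀n₁ : B₀ σ N f₀ n₁ = ϖ * (1 + σ α * q) := by
    simp only [hf₀, map_add, LinearMap.add_apply, form_smul_left, h₀₁, hB₁₁]; ring
  have hw : Valued.v (1 + σ α * q) = 1 := by
    refine Valuation.map_one_add_of_lt _ ?_
    rw [map_mul, hvσ]
    calc Valued.v α * Valued.v q ≤ Valued.v c * 1 := mul_le_mul' hαv hvq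
      _ < 1 := by rw [mul_one]; exact hvc
  have hw0 : (1 + σ α * q) ≠ 0 := fun h => by rw [h, map_zero] at hw; exact zero_ne_one hw
  set g₂ : Fin N → K := (1 + σ α * q)⁻¹ • n₁ with hg₂
  have hg₂M : g₂ ∈ M := smul_mem_of_v_le _ (by rw [map_inv₀, hw, inv_one]) hn₁
  have hxg₂ : B₀ σ N x g₂ = 0 := by rw [hg₂, form_smul_right, hx₁, mul_zero]
  have hf₀g₂ : B₀ σ N f₀ g₂ = ϖ := by rw [hg₂, form_smul_right, hf₀n₁]; field_simp
  have hg₂f₀ : B₀ σ N g₂ f₀ = -ϖ := by rw [herm, hf₀g₂, hσϖ]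
  -- `ρ' = h(g₂,g₂)/ϖ ∈ 𝒪`, anti-fixed
  obtain ⟨ρ', hρ', hσρ', hvρ'⟩ : ∃ ρ' : K, B₀ σ N g₂ g₂ = ϖ * ρ' ∧ σ ρ' = -ρ' ∧ Valued.v ρ' ≤ 1 := by
    refine ⟨B₀ σ N g₂ g₂ / ϖ, by field_simp, by rw [map_div₀, hσϖ, (isHermitianForm_B₀ hσ).apply_self g₂, div_neg], ?_⟩
    rw [map_div₀]
    refine div_le_one_of_le₀ ?_ zero_le
    rw [hg₂, form_smul_left, form_smul_right, map_mul, map_mul, hvσ, map_inv₀, hw, inv_one, one_mul, one_mul]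
    exact h₁₁
  -- `f₂ = g₂ + ν f₀`, `ν = ρ'/2`
  set ν : K := ρ' / 2 with hν
  have hvν : Valued.v ν ≤ 1 := by rw [hν, map_div₀, h2, div_one]; exact hvρ'
  have hσν : σ ν = -(ρ' / 2) := by rw [hν, map_div₀, hσρ', map_ofNat, neg_div]
  set f₂ : Fin N → K := g₂ + ν • f₀ with hf₂
  have hf₂M : f₂ ∈ M := M.add_mem hg₂M (smul_mem_of_v_le _ hvν hf₀M)
  have hxf₂ : B₀ σ N x f₂ = 0 := by rw [hf₂, map_add, hxg₂, form_smul_right, hxf₀, mul_zero, add_zero]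
  have hf₂f₂ : B₀ σ N f₂ f₂ = 0 := by
    have h : B₀ σ N f₂ f₂ = ϖ * ρ' + ν * (-ϖ) + σ ν * ϖ := by
      simp only [hf₂, map_add, LinearMap.add_apply, form_smul_left, form_smul_right, hg₂f₀, hf₀g₂, hf₀f₀, hρ']; ring
    rw [h, hσν, hν]
    field_simp
    ring
  have hf₀f₂ : B₀ σ N f₀ f₂ = ϖ := by rw [hf₂, map_add, hf₀g₂, form_smul_right, hf₀f₀, mul_zero, add_zero]
  exact ⟨f₀, f₂, hf₀M, hf₂M, hf₀f₀, hf₂f₂, hf₀f₂, hxf₀, hxf₂⟩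

/-! ## §4 The adapted vectors of a type-two vertex at a ramified place -/

/-- **ADAPTED VECTORS OF A TYPE-TWO VERTEX AT A TAMELY RAMIFIED PLACE** (twin of ★ `exists_adapted_vectors_of_isVertexLattice_two`).  Every type-two vertex lattice `M` of `(K³, J₀)`
contains `x, f₀, f₂` with `|h(x,x)| = 1`, `x ⊥ f₀, f₂`, `h(f₀,f₀) = h(f₂,f₂) = 0`, `h(f₀,f₂) = ϖ`: FILE 1's orthogonal basis and type-two block (trace element `t = 1∕2`) + §2 + §3.
[cite: Jacobowitz1962, §4, §8] [cite: Omeara1963, §82F, §93] -/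
theorem exists_adapted_vectors_of_isVertexLattice_two_of_neg (hσ : ∀ x, σ (σ x) = x) (hvσ : ∀ a, Valued.v (σ a) = Valued.v a)
    (hϖ : Valued.v ϖ = WithZero.exp (-1 : ℤ)) (hσϖ : σ ϖ = -ϖ) (hres : ∀ x : K, Valued.v x ≤ 1 → Valued.v (σ x - x) < 1) (h2 : Valued.v (2 : K) = 1)
    (hnorm : ∀ u : K, σ u = u → Valued.v (u - 1) < 1 → ∃ z : K, z * σ z = u ∧ Valued.v (z - 1) ≤ Valued.v (u - 1))
    {M : Submodule 𝒪[K] (Fin 3 → K)} (hM : IsVertexLattice σ ϖ ((StdForm.antidiagonal 3).over K) 2 M) :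
    ∃ x f₀ f₂ : Fin 3 → K, x ∈ M ∧ f₀ ∈ M ∧ f₂ ∈ M ∧ Valued.v (B₀ σ 3 x x) = 1 ∧ B₀ σ 3 x f₀ = 0 ∧ B₀ σ 3 x f₂ = 0 ∧
      B₀ σ 3 f₀ f₀ = 0 ∧ B₀ σ 3 f₂ f₂ = 0 ∧ B₀ σ 3 f₀ f₂ = ϖ := by
  have hϖ0 : ϖ ≠ 0 := uniformizer_ne_zero hϖ
  have h20 : (2 : K) ≠ 0 := fun h => by rw [h, map_zero] at h2; exact zero_ne_one h2
  have htrace : ∃ t : K, Valued.v t ≤ 1 ∧ t + σ t = 1 :=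
    ⟨1 / 2, by rw [map_div₀, map_one, h2, div_one], by rw [map_div₀, map_one, map_ofNat, ← add_div, one_add_one_eq_two, div_self h20]⟩
  obtain ⟨g, rfl, hx, h01, h02⟩ := exists_orthogonal_basis_of_trace hσ hvσ hϖ htrace hM
  obtain ⟨hblk, hdet⟩ := typeTwo_block_of_involution hσ hvσ hϖ0 hM hx h01 h02
  obtain ⟨n₀, n₁, hn₀, hn₁, hxn₀, hxn₁, h₀₀, h₀₁, h₁₁⟩ := exists_near_hyperbolic_pair_of_neg hσ hvσ hϖ hσϖ hres h2 (latt (g : Matrix (Fin 3) (Fin 3) K))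
    (mulVec_single_mem_latt _ 1) (mulVec_single_mem_latt _ 2) h01 h02 (hblk 1 1 (by decide) (by decide)) (hblk 1 2 (by decide) (by decide))
    (hblk 2 1 (by decide) (by decide)) (hblk 2 2 (by decide) (by decide)) hdet
  obtain ⟨f₀, f₂, hf₀, hf₂, hf₀f₀, hf₂f₂, hf₀f₂, hxf₀, hxf₂⟩ :=
    exists_hyperbolic_pair_of_near_pair_of_neg hσ hvσ hϖ hσϖ h2 hnorm (latt (g : Matrix (Fin 3) (Fin 3) K)) hn₀ hn₁ hxn₀ hxn₁ h₀₀ h₀₁ h₁₁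
  exact ⟨_, f₀, f₂, mulVec_single_mem_latt _ 0, hf₀, hf₂, hx, hxf₀, hxf₂, hf₀f₀, hf₂f₂, hf₀f₂⟩

/-! ## §5 `N₁` is a type-two vertex at a ramified place; type-two transitivity -/

/-- **`N₁ = latt diag(1,1,ϖ)` is a type-two vertex at a ramified place** (`σϖ = −ϖ`): its Gram matrix is `[[0,0,ϖ],[0,1,0],[−ϖ,0,0]]`, integral, `ϖ·G⁻¹ = [[0,0,−1],[0,ϖ,0],[1,0,0]]`
integral, `det = ϖ²`.  (Compare ★ `isVertexLattice_two_latt_diagonal_one_one`, stated with `σϖ = ϖ`.) [cite: BruhatTits1972, §10] [cite: Jacobowitz1962, §8] -/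
theorem isVertexLattice_two_N₁_of_neg (hσϖ : σ ϖ = -ϖ) (hϖ : Valued.v ϖ = WithZero.exp (-1 : ℤ)) :
    IsVertexLattice σ ϖ ((StdForm.antidiagonal 3).over K) 2 (latt (Matrix.diagonal ![(1 : K), 1, ϖ])) := by
  have hϖ0 : ϖ ≠ 0 := uniformizer_ne_zero hϖ
  have hϖ1 : Valued.v ϖ ≤ 1 := by rw [hϖ, ← WithZero.exp_zero]; exact WithZero.exp_le_exp.2 (by norm_num)
  have hJ : ∀ i j : Fin 3, (StdForm.antidiagonal 3).over K i j = if j = Fin.rev i then (1 : K) else 0 := by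
    intro i j
    simp only [StdForm.over, Matrix.map_apply, StdForm.antidiagonal_J_apply]
    split_ifs <;> simp
  have hgdet0 : (Matrix.diagonal ![(1 : K), 1, ϖ]).det ≠ 0 := by
    rw [Matrix.det_diagonal, Fin.prod_univ_three]; simp [hϖ0]
  have hG : formCongr σ (Matrix.GeneralLinearGroup.mkOfDetNeZero _ hgdet0) ((StdForm.antidiagonal 3).over K) = !![0, 0, ϖ; 0, 1, 0; -ϖ, 0, 0] := by
    rw [formCongr, Matrix.GeneralLinearGroup.val_mkOfDetNeZero]
    ext i j
    fin_cases i <;> fin_cases j <;> simp [Matrix.mul_apply, Fin.sum_univ_three, hJ, hσϖ, Fin.rev, Matrix.map_apply, Matrix.diagonal]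
  have hGinv : (!![0, 0, ϖ; 0, 1, 0; -ϖ, 0, 0] : Matrix (Fin 3) (Fin 3) K)⁻¹ = !![0, 0, -ϖ⁻¹; 0, 1, 0; ϖ⁻¹, 0, 0] := by
    apply Matrix.inv_eq_left_inv
    ext i j
    fin_cases i <;> fin_cases j <;> simp [Matrix.mul_apply, Fin.sum_univ_three, hϖ0]
  have hGdet : (!![0, 0, ϖ; 0, 1, 0; -ϖ, 0, 0] : Matrix (Fin 3) (Fin 3) K).det = ϖ ^ 2 := by
    rw [Matrix.det_fin_three]; simp; ring
  refine ⟨Matrix.GeneralLinearGroup.mkOfDetNeZero _ hgdet0, by rw [Matrix.GeneralLinearGroup.val_mkOfDetNeZero], ?_, ?_, ?_⟩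
  · rw [hG]; intro i j; fin_cases i <;> fin_cases j <;> simp [hϖ1]
  · rw [hG, hGinv]; intro i j; fin_cases i <;> fin_cases j <;> simp [hϖ0, hϖ1]
  · rw [hG, hGdet, map_pow]

set_option maxHeartbeats 800000 in
/-- **`U(σ, J₀)` IS TRANSITIVE ON THE TYPE-TWO VERTICES AT A TAMELY RAMIFIED PLACE** (`N = 3`; twin of ★ B-p14 `exists_mapGL_N₁_eq_of_isVertexLattice_two`): every type-two vertex
lattice `M` of `(K³, J₀)` is `u·N₁`, `N₁ = latt diag(1,1,ϖ)`, for some `u ∈ U(σ, J₀)` — the binder `htr₂` of ★ S-a3-ram `exists_isSelfDualLattice_gt_mapGL_eq_of_charpoly_of_neg`.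
From the adapted vectors `x, f₀, f₂ ∈ M` (§4): the Gram matrix of `C = (f₀ | x | f₂)` is `[[0,0,ϖ],[0,ε,0],[−ϖ,0,0]]` (`h(f₂,f₀) = σϖ = −ϖ`) of determinant `εϖ² = −N(det C)`, so
`ε = N(det C ∕ ϖ)` (as `ϖ·σϖ = −ϖ²`); `c₁ = (det C∕ϖ)⁻¹x` has `h(c₁,c₁) = 1`; `u = (f₀ | c₁ | ϖ⁻¹f₂)` satisfies `ᵗσ(u)J₀u = J₀` (`σ(ϖ⁻¹)·(−ϖ) = 1`) and `u·N₁ = latt(f₀|c₁|f₂) ≤ M`,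
two type-two vertices, equal by (D1)∕(D2). [cite: Jacobowitz1962, §4, §8] [cite: BruhatTits1972, §10] -/
theorem exists_mapGL_N₁_eq_of_isVertexLattice_two_of_neg (hσ : ∀ x, σ (σ x) = x) (hvσ : ∀ a, Valued.v (σ a) = Valued.v a)
    (hϖ : Valued.v ϖ = WithZero.exp (-1 : ℤ)) (hσϖ : σ ϖ = -ϖ) (hres : ∀ x : K, Valued.v x ≤ 1 → Valued.v (σ x - x) < 1) (h2 : Valued.v (2 : K) = 1)
    (hnorm : ∀ u : K, σ u = u → Valued.v (u - 1) < 1 → ∃ z : K, z * σ z = u ∧ Valued.v (z - 1) ≤ Valued.v (u - 1))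
    {M : Submodule 𝒪[K] (Fin 3 → K)} (hM : IsVertexLattice σ ϖ ((StdForm.antidiagonal 3).over K) 2 M) :
    ∃ u : unitaryGroupOfForm σ ((StdForm.antidiagonal 3).over K), M = mapGL (u : GL (Fin 3) K) (latt (Matrix.diagonal ![(1 : K), 1, ϖ])) := by
  have hϖ0 : ϖ ≠ 0 := uniformizer_ne_zero hϖ
  have herm : ∀ y z : Fin 3 → K, B₀ σ 3 z y = σ (B₀ σ 3 y z) := fun y z => (isHermitianForm_B₀ hσ y z).symm
  obtain ⟨x, f₀, f₂, hxM, hf₀M, hf₂M, hx, hxf₀, hxf₂, hf₀f₀, hf₂f₂, hf₀f₂⟩ := exists_adapted_vectors_of_isVertexLattice_two_of_neg hσ hvσ hϖ hσϖ hres h2 hnorm hM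
  have hε0 : B₀ σ 3 x x ≠ 0 := fun h => by rw [h, map_zero] at hx; exact zero_ne_one hx
  have hf₀x : B₀ σ 3 f₀ x = 0 := by rw [herm, hxf₀, map_zero]
  have hf₂x : B₀ σ 3 f₂ x = 0 := by rw [herm, hxf₂, map_zero]
  have hf₂f₀ : B₀ σ 3 f₂ f₀ = -ϖ := by rw [herm, hf₀f₂, hσϖ]
  -- the determinant class `h(x,x) = N(z)`, `z = det C / ϖ` (note `ϖ·σϖ = −ϖ²`)
  set C : Matrix (Fin 3) (Fin 3) K := (Matrix.of ![f₀, x, f₂])ᵀ with hC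
  have hC0 : C.mulVec (Pi.single 0 1) = f₀ := transpose_of_mulVec_single _ 0
  have hC1 : C.mulVec (Pi.single 1 1) = x := transpose_of_mulVec_single _ 1
  have hC2 : C.mulVec (Pi.single 2 1) = f₂ := transpose_of_mulVec_single _ 2
  have hGram : (C.map σ)ᵀ * (StdForm.antidiagonal 3).over K * C = !![0, 0, ϖ; 0, B₀ σ 3 x x, 0; -ϖ, 0, 0] := by
    ext i j
    rw [← B₀_mulVec_single_eq_gram]
    fin_cases i <;> fin_cases j <;>
      simp only [Fin.zero_eta, Fin.mk_one, Fin.reduceFinMk, hC0, hC1, hC2, hf₀f₀, hf₀x, hf₀f₂, hxf₀, hxf₂, hf₂f₀, hf₂x, hf₂f₂] <;> rfl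
  have hdetC : σ C.det * C.det = -(B₀ σ 3 x x * ϖ ^ 2) := by
    have hdet3 : (!![0, 0, ϖ; 0, B₀ σ 3 x x, 0; -ϖ, 0, 0] : Matrix (Fin 3) (Fin 3) K).det = B₀ σ 3 x x * ϖ ^ 2 := by
      simp [Matrix.det_fin_three]; ring
    have h := det_gram_three (σ := σ) C
    rw [hGram, hdet3] at h
    linear_combination h
  set z : K := C.det / ϖ with hz
  have hzz : σ z * z = B₀ σ 3 x x := by
    rw [hz, map_div₀, hσϖ, div_mul_div_comm, hdetC, neg_mul, neg_div_neg_eq, pow_two, mul_div_assoc, div_self (mul_ne_zero hϖ0 hϖ0), mul_one]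
  have hvz : Valued.v z = 1 := by
    apply eq_one_of_mul_self_eq_one
    rw [show Valued.v z * Valued.v z = Valued.v (σ z * z) by rw [map_mul, hvσ], hzz]; exact hx
  have hz0 : z ≠ 0 := fun h => by rw [h, map_zero] at hvz; exact zero_ne_one hvz
  have hσz0 : σ z ≠ 0 := (map_ne_zero σ).2 hz0
  -- the unit vector `c₁ = z⁻¹ x`
  set c₁ : Fin 3 → K := z⁻¹ • x with hc₁
  have hc₁M : c₁ ∈ M := smul_mem_of_v_le _ (by rw [map_inv₀, hvz, inv_one]) hxM
  have hc₁c₁ : B₀ σ 3 c₁ c₁ = 1 := by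
    rw [hc₁, form_smul_left, form_smul_right, ← hzz, map_inv₀]; field_simp
  have hc₁f₀ : B₀ σ 3 c₁ f₀ = 0 := by rw [hc₁, form_smul_left, hxf₀, mul_zero]
  have hc₁f₂ : B₀ σ 3 c₁ f₂ = 0 := by rw [hc₁, form_smul_left, hxf₂, mul_zero]
  have hf₀c₁ : B₀ σ 3 f₀ c₁ = 0 := by rw [herm, hc₁f₀, map_zero]
  have hf₂c₁ : B₀ σ 3 f₂ c₁ = 0 := by rw [herm, hc₁f₂, map_zero]
  -- the unitary matrix `u = (f₀ | c₁ | ϖ⁻¹ f₂)`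
  have hσϖi : σ ϖ⁻¹ = -ϖ⁻¹ := by rw [map_inv₀, hσϖ, inv_neg]
  set U : Matrix (Fin 3) (Fin 3) K := (Matrix.of ![f₀, c₁, ϖ⁻¹ • f₂])ᵀ with hU
  have hU0 : U.mulVec (Pi.single 0 1) = f₀ := transpose_of_mulVec_single _ 0
  have hU1 : U.mulVec (Pi.single 1 1) = c₁ := transpose_of_mulVec_single _ 1
  have hU2 : U.mulVec (Pi.single 2 1) = ϖ⁻¹ • f₂ := transpose_of_mulVec_single _ 2
  have hUJ : (U.map σ)ᵀ * (StdForm.antidiagonal 3).over K * U = (StdForm.antidiagonal 3).over K := by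
    ext i j
    rw [← B₀_mulVec_single_eq_gram, UnitaryGroup.antidiagonal_three_over_eq]
    fin_cases i <;> fin_cases j <;>
      simp only [Fin.zero_eta, Fin.mk_one, Fin.reduceFinMk, hU0, hU1, hU2, form_smul_left, form_smul_right, hσϖi, hf₀f₀, hf₀c₁, hf₀f₂, hc₁f₀, hc₁c₁, hc₁f₂,
        hf₂f₀, hf₂c₁, hf₂f₂, mul_zero, neg_mul, mul_neg, neg_neg, inv_mul_cancel₀ hϖ0] <;> rfl
  have hdetU : U.det ≠ 0 := by
    intro h
    have h2' := congrArg Matrix.det hUJ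
    rw [det_gram_three, h, mul_zero, neg_zero, det_antidiagonal_three] at h2'
    norm_num at h2'
  set u : GL (Fin 3) K := Matrix.GeneralLinearGroup.mkOfDetNeZero U hdetU with hu
  have huval : (u : Matrix (Fin 3) (Fin 3) K) = U := rfl
  have huU : u ∈ unitaryGroupOfForm σ ((StdForm.antidiagonal 3).over K) := by rw [mem_unitaryGroupOfForm_iff, huval]; exact hUJ
  refine ⟨⟨u, huU⟩, ?_⟩
  change M = mapGL u (latt (Matrix.diagonal ![(1 : K), 1, ϖ]))
  -- `u·N₁ = latt (f₀ | c₁ | f₂) ≤ M`, both type two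
  have hle : mapGL u (latt (Matrix.diagonal ![(1 : K), 1, ϖ])) ≤ M := by
    rw [mapGL_latt_eq, huval, latt_le_iff_forall_mulVec_single_mem]
    intro j
    rw [← Matrix.mulVec_mulVec, Matrix.diagonal_mulVec_single, mul_one]
    fin_cases j
    · simp only [Fin.zero_eta]; rw [show (![(1 : K), 1, ϖ] : Fin 3 → K) 0 = 1 from rfl, hU0]; exact hf₀M
    · simp only [Fin.mk_one]; rw [show (![(1 : K), 1, ϖ] : Fin 3 → K) 1 = 1 from rfl, hU1]; exact hc₁M
    · simp only [Fin.reduceFinMk]; rw [show (![(1 : K), 1, ϖ] : Fin 3 → K) 2 = ϖ from rfl]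
      have h2'' : (Pi.single 2 ϖ : Fin 3 → K) = ϖ • Pi.single 2 1 := by
        ext i; rw [Pi.smul_apply, Pi.single_apply, Pi.single_apply, smul_eq_mul, mul_ite, mul_one, mul_zero]
      rw [h2'', Matrix.mulVec_smul, hU2, smul_smul, mul_inv_cancel₀ hϖ0, one_smul]; exact hf₂M
  have htwo : IsVertexLattice σ ϖ ((StdForm.antidiagonal 3).over K) 2 (mapGL u (latt (Matrix.diagonal ![(1 : K), 1, ϖ]))) :=
    isVertexLattice_mapGL σ ϖ _ u huU (isVertexLattice_two_N₁_of_neg hσϖ hϖ)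
  exact (eq_of_le_of_isVertexLattice hvσ hϖ0 htwo hM hle).symm

/-- **The binder `htr₂` of ★ S-a3-ram holds at every tamely ramified place.** [cite: Jacobowitz1962, §8] [cite: BruhatTits1972, §10] -/
theorem forall_isVertexLattice_two_exists_mapGL_N₁_eq_of_neg (hσ : ∀ x, σ (σ x) = x) (hvσ : ∀ a, Valued.v (σ a) = Valued.v a)
    (hϖ : Valued.v ϖ = WithZero.exp (-1 : ℤ)) (hσϖ : σ ϖ = -ϖ) (hres : ∀ x : K, Valued.v x ≤ 1 → Valued.v (σ x - x) < 1) (h2 : Valued.v (2 : K) = 1)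
    (hnorm : ∀ u : K, σ u = u → Valued.v (u - 1) < 1 → ∃ z : K, z * σ z = u ∧ Valued.v (z - 1) ≤ Valued.v (u - 1)) :
    ∀ M : Submodule 𝒪[K] (Fin 3 → K), IsVertexLattice σ ϖ ((StdForm.antidiagonal 3).over K) 2 M →
      ∃ u : unitaryGroupOfForm σ ((StdForm.antidiagonal 3).over K), M = mapGL (u : GL (Fin 3) K) (latt (Matrix.diagonal ![(1 : K), 1, ϖ])) :=
  fun _ hM => exists_mapGL_N₁_eq_of_isVertexLattice_two_of_neg hσ hvσ hϖ hσϖ hres h2 hnorm hM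

end Ramified

end Literature.NumberTheory.Automorphic.UnitaryLatticeTree

end
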